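import Literature.NumberTheory.Weil1964.LocalGaussIntegralSeveralVariables
import Literature.NumberTheory.Weil1964.LocalWeilIndex
import Literature.NumberTheory.Automorphic.LocalPiSchwartzBruhatFourier
import HarnessLib

/-!
# Decay of the Gauss transform of a diagonal quadratic form over a non-archimedean local field

Topic `NumberTheory/Weil1965`; namespace `Literature.NumberTheory.Weil1965`.  KERNEL mathematics only (theorems; no
definition, no named fact, no `axiom`, no proof hole).

`F` a non-archimedean local field, `μ` an additive Haar measure, `ψ` an additive character of conductor exponent `d`,
`‖2‖_F = q^{-v₂}`, and `f(x) = Σᵢ cᵢ xᵢ²` a DIAGONAL non-degenerate quadratic form on `X = F^ι` (`cᵢ ≠ 0`, `r = card ι`).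
For a Schwartz–Bruhat `Φ` on `X` Weil's local Gauss transform `G_Φ(β) = ∫_X Φ(x) ψ(β f(x)) dμ^⊗ι(x)` (written out as
`∫ x, Φ x * psiSqPi ψ (β • c) x ∂μ^⊗ι`; the sequel names it) is the Fourier transform (Tate's convention) of the push-forward of `Φ dμ^⊗ι` under `f`.  This file proves Weil's DECAY
ESTIMATE [Weil1965, Chap. I n° 2 Prop. 2]  `‖G_Φ(β)‖ ≤ C_Φ ‖β‖^{-r/2}` (`β ≠ 0`) in the tree's exponent currency
`‖β‖ = q^{-j} ⟹ ‖G_Φ(β)‖ ≤ C (√q)^{r j}` (`exists_norm_integral_mul_psiSqPi_le_of_mem_schwartzBruhat`), with the trivial bound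
`‖G_Φ(β)‖ ≤ ∫ ‖Φ‖`.  Road ([Weil1964] n° 25–27 in the tree's one-variable files):

* §1 ONE VARIABLE, ONE COSET: `‖∫_{x₀ + 𝔭^ℓ} ψ(a x²) dx‖ ≤ C (√q)^{v}` for `‖a‖ = q^{-v}` — on the zero coset this is the
  modulus `|g(a, 𝔭^ℓ)|² = μ(𝔭^ℓ) μ(𝔭^{d-ℓ-v-v₂})` (★ `norm_sq_gaussBall`) on the stable range; OFF the zero coset the integral
  VANISHES for `‖a‖` large (translate by `h ∈ 𝔭^k` with `a h² ∈ 𝔭^d`, `2a 𝔭^{ℓ+k} ⊆ 𝔭^d`, `ψ(2 a x₀ h) ≠ 1`);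
* §2 `r` VARIABLES: Fubini over a coset `Π(aᵢ + 𝔭^ℓ)` (★ `setIntegral_pi_psiSqPi`) and the step decomposition of a
  Schwartz–Bruhat function on `F^ι` (★ `exists_finset_eq_sum_const_mul_indicator_pi`).

Sequel (`LocalQuadraticFibreDensity.lean`): for `r ≥ 3` the decay makes `G_Φ` integrable and its inverse Fourier
transform is the CONTINUOUS fibre density of `f_*(Φ μ^⊗ι)` [Weil1965, n° 36 Prop. 6].

## References

* [Weil1965] A. Weil, *Sur la formule de Siegel dans la théorie des groupes classiques*, Acta Math. 113 (1965) 1–87: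
  Chap. I n° 2 Prop. 2 (p. 8); Chap. III n° 36 Prop. 6 (p. 54).
* [Weil1964] A. Weil, *Sur certains groupes d'opérateurs unitaires*, Acta Math. 111 (1964) 143–211: Chap. I n° 14
  Thm 2 Cor. 2 (p. 162), Chap. II n° 25–27 (pp. 173–175).
-/

set_option autoImplicit false

noncomputable section

open MeasureTheory ValuativeRel Filter Topology Set
open scoped NNReal ENNReal Pointwise
open Literature.NumberTheory.GaloisRepresentations.IsNonarchimedeanLocalField
open Literature.NumberTheory.Automorphic
open Literature.NumberTheory.Weil1964

namespace Literature.NumberTheory.Weil1965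

variable {F : Type*} [Field F] [ValuativeRel F] [TopologicalSpace F] [IsNonarchimedeanLocalField F]

/-! ## §0 Exponent bookkeeping -/

section Bookkeeping

/-- `a ∈ 𝔭^m` and `‖a‖ = q^{-v}` give `m ≤ v` (helper). [folklore] -/
private theorem normAbs_notMem_aux {a : F} {v m : ℤ} (ha : normAbs F a = (residueFieldCard F : ℝ≥0)⁻¹ ^ v)
    (h : a ∈ primePowBall F m) : m ≤ v := by
  rw [mem_primePowBall_iff, ha, inv_residueFieldCard_zpow_le_iff] at h
  exact h

/-- `‖x₀‖ = q^{-s}` and `x₀ ∉ 𝔭^ℓ` force `s < ℓ`. [folklore] -/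
private theorem lt_of_normAbs_eq_of_notMem {x₀ : F} {s ℓ : ℤ}
    (hs : normAbs F x₀ = (residueFieldCard F : ℝ≥0)⁻¹ ^ s) (hx₀ : x₀ ∉ primePowBall F ℓ) : s < ℓ := by
  by_contra h
  push Not at h
  exact hx₀ (by rw [mem_primePowBall_iff, hs, inv_residueFieldCard_zpow_le_iff]; exact h)

/-- `1 < √q`. [folklore] -/
private theorem one_lt_sqrt_residueFieldCard : (1 : ℝ) < Real.sqrt (residueFieldCard F) := by
  rw [Real.lt_sqrt zero_le_one, one_pow]
  exact_mod_cast one_lt_residueFieldCard F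

/-- `0 < √q`. [folklore] -/
private theorem sqrt_residueFieldCard_pos : (0 : ℝ) < Real.sqrt (residueFieldCard F) :=
  zero_lt_one.trans one_lt_sqrt_residueFieldCard

/-- `((√q)^v)² = q^v = ((q⁻¹)^v)⁻¹` (`v ∈ ℤ`). [folklore] -/
private theorem sqrt_residueFieldCard_zpow_sq (v : ℤ) :
    (Real.sqrt (residueFieldCard F) ^ v) ^ 2 = (((residueFieldCard F : ℝ)⁻¹) ^ v)⁻¹ := by
  rw [← zpow_natCast, ← zpow_mul, mul_comm, zpow_mul, zpow_natCast,
    Real.sq_sqrt (Nat.cast_nonneg _), inv_zpow, inv_inv]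

/-- monotonicity of `v ↦ (√q)^v`. [folklore] -/
private theorem sqrt_residueFieldCard_zpow_le_zpow {v w : ℤ} (h : v ≤ w) :
    Real.sqrt (residueFieldCard F) ^ v ≤ Real.sqrt (residueFieldCard F) ^ w :=
  zpow_le_zpow_right₀ one_lt_sqrt_residueFieldCard.le h

end Bookkeeping

/-! ## §1 One variable: the Gauss integral over a single coset `x₀ + 𝔭^ℓ` -/

section OneVariable

variable [MeasurableSpace F] [BorelSpace F] (μ : Measure F) [μ.IsAddHaarMeasure] {ψ : AddChar F Circle}

/-- **Off the zero coset the Gauss integral vanishes for `‖a‖` large** [Weil1964, Chap. II n° 27, p. 175: the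
cosets of `M'/L` off `L'` contribute `0`]: if `x₀ ∉ 𝔭^ℓ`, `‖x₀‖ = q^{-s}`, `‖a‖ = q^{-v}`, `‖2‖ = q^{-v₂}`, `ψ` of
conductor exponent `d`, and `v ≤ d - 2 - 2 v₂ - 2 s`, `v ≤ d - 1 - v₂ - s - ℓ`, then `∫_{x₀ + 𝔭^ℓ} ψ(a x²) dx = 0`.
Proof: with `k = d - 1 - v - v₂ - s` (`≥ ℓ`) pick `h ∈ 𝔭^k` with `ψ(2 a x₀ h) ≠ 1` (★ conductor exponent); the
substitution `x ↦ x + h` preserves the coset and multiplies the integrand by the CONSTANT `ψ(2 a x₀ h)` (`a h² ∈ 𝔭^d`,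
`2 a (x - x₀) h ∈ 𝔭^d`). [cite: Weil1964, Chap. II n° 27, pp. 174–175] -/
theorem setIntegral_vadd_primePowBall_psiSq_eq_zero_of_notMem {d : ℤ} (hd : ψ.HasConductorExp d) {a : F}
    {v : ℤ} (ha : normAbs F a = (residueFieldCard F : ℝ≥0)⁻¹ ^ v) {v₂ : ℤ}
    (h2 : normAbs F (2 : F) = (residueFieldCard F : ℝ≥0)⁻¹ ^ v₂) {x₀ : F} {s ℓ : ℤ}
    (hs : normAbs F x₀ = (residueFieldCard F : ℝ≥0)⁻¹ ^ s) (hx₀ : x₀ ∉ primePowBall F ℓ)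
    (hv1 : v ≤ d - 2 - 2 * v₂ - 2 * s) (hv2 : v ≤ d - 1 - v₂ - s - ℓ) :
    ∫ x in x₀ +ᵥ primePowBall F ℓ, psiSq ψ a x ∂μ = 0 := by
  have hsℓ : s < ℓ := lt_of_normAbs_eq_of_notMem hs hx₀
  set k : ℤ := d - 1 - v - v₂ - s with hkdef
  have hkℓ : ℓ ≤ k := by omega
  -- `2 a x₀ ∉ 𝔭^{d-k}`: its absolute value is `q^{-(v₂+v+s)}` and `v₂ + v + s = d - k - 1 < d - k`
  have h2ax₀ : normAbs F (2 * a * x₀) = (residueFieldCard F : ℝ≥0)⁻¹ ^ (v₂ + v + s) := by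
    rw [map_mul, map_mul, h2, ha, hs, ← zpow_add₀ inv_residueFieldCard_pos.ne',
      ← zpow_add₀ inv_residueFieldCard_pos.ne']
  have hnot : 2 * a * x₀ ∉ primePowBall F (d - k) := by
    intro hmem
    have := normAbs_notMem_aux h2ax₀ hmem
    omega
  obtain ⟨h, hh, hne⟩ := exists_mem_primePowBall_addChar_mul_ne_one hd hnot
  have hne' : ((ψ (h * (2 * a * x₀)) : Circle) : ℂ) ≠ 1 := fun e => hne (Circle.coe_eq_one.1 e)
  -- `a h² ∈ 𝔭^d`
  have hah2 : a * h ^ 2 ∈ primePowBall F d := by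
    have hav : a ∈ primePowBall F v := by rw [mem_primePowBall_iff, ha]
    have h3 := mul_mem_primePowBall (mul_mem_primePowBall hav hh) hh
    rw [show a * h * h = a * h ^ 2 by ring] at h3
    exact primePowBall_antitone (by omega) h3
  -- `2 a y h ∈ 𝔭^d` for `y ∈ 𝔭^ℓ`
  have h2ayh : ∀ y ∈ primePowBall F ℓ, 2 * a * y * h ∈ primePowBall F d := by
    intro y hy
    have h2a : 2 * a ∈ primePowBall F (v₂ + v) := by
      rw [mem_primePowBall_iff, map_mul, h2, ha, ← zpow_add₀ inv_residueFieldCard_pos.ne']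
    have h3 := mul_mem_primePowBall (mul_mem_primePowBall h2a hy) hh
    exact primePowBall_antitone (by omega) h3
  -- the translation identity `I = ψ(2 a x₀ h) · I`
  have key : ∫ x in x₀ +ᵥ primePowBall F ℓ, psiSq ψ a x ∂μ =
      ((ψ (h * (2 * a * x₀)) : Circle) : ℂ) * ∫ x in x₀ +ᵥ primePowBall F ℓ, psiSq ψ a x ∂μ := by
    rw [← integral_indicator (measurableSet_vadd_primePowBall ℓ x₀), ← integral_const_mul,
      ← integral_add_left_eq_self _ h]
    refine integral_congr_ae (Eventually.of_forall fun x => ?_)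
    simp only
    by_cases hx : x ∈ x₀ +ᵥ primePowBall F ℓ
    · have hx' : h + x ∈ x₀ +ᵥ primePowBall F ℓ := by
        rw [mem_vadd_primePowBall_iff] at hx ⊢
        have e : h + x - x₀ = (x - x₀) + h := by ring
        rw [e]
        exact add_mem_primePowBall hx (primePowBall_antitone hkℓ hh)
      rw [Set.indicator_of_mem hx', Set.indicator_of_mem hx]
      -- `ψ(a (h+x)²) = ψ(a x²) ψ(2 a x₀ h)` since `a h² ∈ 𝔭^d` and `2 a (x - x₀) h ∈ 𝔭^d`
      have hy : x - x₀ ∈ primePowBall F ℓ := (mem_vadd_primePowBall_iff).1 hx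
      have e1 : a * (h + x) ^ 2 = a * x ^ 2 + (h * (2 * a * x₀) + (2 * a * (x - x₀) * h + a * h ^ 2)) := by ring
      rw [psiSq_apply, psiSq_apply, e1, AddChar.map_add_eq_mul, AddChar.map_add_eq_mul, AddChar.map_add_eq_mul,
        hd.1 _ (h2ayh _ hy), hd.1 _ hah2, mul_one, mul_one, Circle.coe_mul, mul_comm]
    · have hx' : h + x ∉ x₀ +ᵥ primePowBall F ℓ := by
        intro hx'
        apply hx
        rw [mem_vadd_primePowBall_iff] at hx' ⊢
        have e : x - x₀ = (h + x - x₀) + -h := by ring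
        rw [e]
        exact add_mem_primePowBall hx' (neg_mem_primePowBall (primePowBall_antitone hkℓ hh))
      rw [Set.indicator_of_notMem hx', Set.indicator_of_notMem hx, mul_zero]
  have h5 : (1 - ((ψ (h * (2 * a * x₀)) : Circle) : ℂ)) * ∫ x in x₀ +ᵥ primePowBall F ℓ, psiSq ψ a x ∂μ = 0 := by
    rw [sub_mul, one_mul, ← key, sub_self]
  exact (mul_eq_zero.1 h5).resolve_left (sub_ne_zero.2 (Ne.symm hne'))


omit [BorelSpace F] [μ.IsAddHaarMeasure] in
/-- on the zero coset the integral is Weil's `g(a, 𝔭^ℓ)`. [cite: Weil1964, Chap. II n° 27, p. 175] -/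
theorem setIntegral_vadd_primePowBall_psiSq_eq_gaussBall_of_mem {x₀ : F} {ℓ : ℤ} (hx₀ : x₀ ∈ primePowBall F ℓ)
    (a : F) : ∫ x in x₀ +ᵥ primePowBall F ℓ, psiSq ψ a x ∂μ = gaussBall ψ μ a ℓ := by
  have h0 : x₀ ∈ (0 : F) +ᵥ primePowBall F ℓ := by rwa [zero_vadd]
  rw [vadd_primePowBall_eq_of_mem h0, zero_vadd, gaussBall_def]

omit [BorelSpace F] [μ.IsAddHaarMeasure] in
/-- the trivial bound `‖∫_{x₀+𝔭^ℓ} ψ(a x²) dx‖ ≤ μ(𝔭^ℓ)` (the integrand has modulus `1`). [folklore] -/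
private theorem norm_setIntegral_vadd_primePowBall_psiSq_le_measureReal [IsFiniteMeasureOnCompacts μ]
    [μ.IsAddLeftInvariant] (a x₀ : F) (ℓ : ℤ) :
    ‖∫ x in x₀ +ᵥ primePowBall F ℓ, psiSq ψ a x ∂μ‖ ≤ μ.real (primePowBall F ℓ) := by
  have hfin : μ (x₀ +ᵥ primePowBall F ℓ) < ∞ := (isCompact_vadd_primePowBall ℓ x₀).measure_lt_top
  calc ‖∫ x in x₀ +ᵥ primePowBall F ℓ, psiSq ψ a x ∂μ‖ ≤ 1 * μ.real (x₀ +ᵥ primePowBall F ℓ) :=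
        norm_setIntegral_le_of_norm_le_const hfin fun x _ => (norm_psiSq ψ a x).le
    _ = μ.real (primePowBall F ℓ) := by
        rw [one_mul, measureReal_def, measureReal_def, measure_vadd]

omit [BorelSpace F] [μ.IsAddHaarMeasure] in
/-- the trivial bound in exponent currency: past a threshold `V` the bound `μ(𝔭^ℓ)` is dominated by
`(μ(𝔭^ℓ) / (√q)^V) · (√q)^v`. [folklore] -/
private theorem trivial_bound_aux {ℓ V v : ℤ} (hv : V ≤ v) :
    μ.real (primePowBall F ℓ) ≤
      μ.real (primePowBall F ℓ) / Real.sqrt (residueFieldCard F) ^ V * Real.sqrt (residueFieldCard F) ^ v := by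
  have hpos : 0 < Real.sqrt (residueFieldCard F : ℝ) ^ V := zpow_pos sqrt_residueFieldCard_pos V
  rw [div_mul_eq_mul_div, le_div_iff₀ hpos]
  exact mul_le_mul_of_nonneg_left (sqrt_residueFieldCard_zpow_le_zpow hv) measureReal_nonneg

/-- **ONE-VARIABLE DECAY over a coset** [Weil1964, Chap. I n° 14 Thm 2 Cor. 2 and Chap. II n° 27]: for `ψ` of
conductor exponent `d`, `‖2‖ = q^{-v₂}` and a coset `x₀ + 𝔭^ℓ`, there is `C ≥ 0` with
`‖∫_{x₀ + 𝔭^ℓ} ψ(a x²) dx‖ ≤ C · (√q)^{v}` whenever `‖a‖ = q^{-v}` — i.e. `≤ C ‖a‖^{-1/2}`.  On the zero coset this is the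
exact modulus `|g(a, 𝔭^ℓ)|² = μ(𝔭^ℓ) μ(𝔭^{d-ℓ-v-v₂})` on the stable range; off it the integral vanishes for `‖a‖` large;
below the thresholds the trivial bound `μ(𝔭^ℓ)` is rescaled.
[cite: Weil1964, Chap. I n° 14 Thm 2 Cor. 2, p. 162; Chap. II n° 27, pp. 174–175] -/
theorem exists_norm_setIntegral_vadd_primePowBall_psiSq_le {d : ℤ} (hd : ψ.HasConductorExp d) {v₂ : ℤ}
    (h2 : normAbs F (2 : F) = (residueFieldCard F : ℝ≥0)⁻¹ ^ v₂) (x₀ : F) (ℓ : ℤ) :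
    ∃ C : ℝ, 0 ≤ C ∧ ∀ (a : F) (v : ℤ), normAbs F a = (residueFieldCard F : ℝ≥0)⁻¹ ^ v →
      ‖∫ x in x₀ +ᵥ primePowBall F ℓ, psiSq ψ a x ∂μ‖ ≤ C * Real.sqrt (residueFieldCard F) ^ v := by
  set sq : ℝ := Real.sqrt (residueFieldCard F) with hsq
  have hsq0 : 0 < sq := sqrt_residueFieldCard_pos
  have hm0 : 0 ≤ μ.real (primePowBall F ℓ) := measureReal_nonneg
  by_cases hx₀ : x₀ ∈ primePowBall F ℓ
  · -- zero coset: `g(a, 𝔭^ℓ)`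
    set V : ℤ := d - 2 * v₂ - 2 * ℓ with hVdef
    set K : ℝ := μ.real (primePowBall F ℓ) * (((residueFieldCard F : ℝ)⁻¹) ^ (d - ℓ - v₂) *
      μ.real (primePowBall F 0)) with hKdef
    have hK0 : 0 ≤ K := by positivity
    refine ⟨Real.sqrt K + μ.real (primePowBall F ℓ) / sq ^ (V + 1), by positivity, fun a v ha => ?_⟩
    rw [setIntegral_vadd_primePowBall_psiSq_eq_gaussBall_of_mem μ hx₀]
    rcases le_or_gt v V with hv | hv
    · -- stable range: exact modulus
      have hstab : 2 * ℓ ≤ d - v - 2 * v₂ := by omega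
      have hsqv : ‖gaussBall ψ μ a ℓ‖ = Real.sqrt K * sq ^ v := by
        have h1 : ‖gaussBall ψ μ a ℓ‖ ^ 2 = (Real.sqrt K * sq ^ v) ^ 2 := by
          rw [norm_sq_gaussBall μ hd ha h2 hstab, mul_pow, Real.sq_sqrt hK0, hsq, sqrt_residueFieldCard_zpow_sq,
            LocalFieldHaar.measureReal_primePowBall μ (d - ℓ - v - v₂), hKdef,
            show d - ℓ - v - v₂ = (d - ℓ - v₂) + (-v) by ring,
            zpow_add₀ (inv_ne_zero (Nat.cast_ne_zero.2 (residueFieldCard_ne_zero F))), zpow_neg]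
          ring
        exact (sq_eq_sq₀ (norm_nonneg _) (by positivity)).1 h1
      rw [hsqv, add_mul]
      exact le_add_of_nonneg_right (by positivity)
    · -- below the stable range: trivial bound
      calc ‖gaussBall ψ μ a ℓ‖ ≤ μ.real (primePowBall F ℓ) := by
            rw [← setIntegral_vadd_primePowBall_psiSq_eq_gaussBall_of_mem μ hx₀]
            exact norm_setIntegral_vadd_primePowBall_psiSq_le_measureReal μ a x₀ ℓ
        _ ≤ μ.real (primePowBall F ℓ) / sq ^ (V + 1) * sq ^ v := trivial_bound_aux μ (by omega)
        _ ≤ (Real.sqrt K + μ.real (primePowBall F ℓ) / sq ^ (V + 1)) * sq ^ v := by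
            rw [add_mul]; exact le_add_of_nonneg_left (by positivity)
  · -- off the zero coset: vanishing for `‖a‖` large
    have hx₀0 : x₀ ≠ 0 := by rintro rfl; exact hx₀ (zero_mem_primePowBall ℓ)
    obtain ⟨s, hs⟩ := exists_normAbs_eq_inv_zpow hx₀0
    set V : ℤ := min (d - 2 - 2 * v₂ - 2 * s) (d - 1 - v₂ - s - ℓ) with hVdef
    refine ⟨μ.real (primePowBall F ℓ) / sq ^ (V + 1), by positivity, fun a v ha => ?_⟩
    rcases le_or_gt v V with hv | hv
    · rw [setIntegral_vadd_primePowBall_psiSq_eq_zero_of_notMem μ hd ha h2 hs hx₀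
        (hv.trans (min_le_left _ _)) (hv.trans (min_le_right _ _)), norm_zero]
      positivity
    · exact (norm_setIntegral_vadd_primePowBall_psiSq_le_measureReal μ a x₀ ℓ).trans
        (trivial_bound_aux μ (by omega))

end OneVariable


/-! ## §2 Several variables: the Gauss transform of a Schwartz–Bruhat function on `F^ι` -/

section SeveralVariables

variable {ι : Type*} [Fintype ι]

omit [Fintype ι] in
/-- a coset of the box `(𝔭^ℓ)^ι` is the product of the coordinate cosets: `a + (𝔭^ℓ)^ι = Π (aᵢ + 𝔭^ℓ)`
(★ `piCoset`). [folklore] -/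
private theorem vadd_piPrimePowBall_eq_piCoset (a : ι → F) (ℓ : ℤ) : a +ᵥ piPrimePowBall F ι ℓ = piCoset F a ℓ := by
  ext x
  rw [mem_vadd_piPrimePowBall_iff, mem_piCoset_iff, mem_piPrimePowBall_iff]
  exact Iff.rfl

variable [MeasurableSpace F] [BorelSpace F] (μ : Measure F) [μ.IsAddHaarMeasure] {ψ : AddChar F Circle}

omit [ValuativeRel F] [TopologicalSpace F] [IsNonarchimedeanLocalField F] [MeasurableSpace F] [BorelSpace F] in
/-- `psiSqPi ψ (β • c) x = ψ(β · Σ cᵢ xᵢ²)`: the kernel of the Gauss transform is the second-degree character of the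
form `β f` [Weil1964, Chap. II n° 24: `χ ∘ f`]. [cite: Weil1964, Chap. II n° 24, p. 172] -/
theorem psiSqPi_smul_apply (c x : ι → F) (β : F) :
    psiSqPi ψ (fun i => β * c i) x = ψ (β * ∑ i, c i * x i ^ 2) := by
  rw [psiSqPi_apply, Finset.mul_sum]
  congr 2
  exact Finset.sum_congr rfl fun i _ => by ring

omit [ValuativeRel F] [TopologicalSpace F] [IsNonarchimedeanLocalField F] [BorelSpace F] [μ.IsAddHaarMeasure] in
/-- the **trivial bound** `‖G_Φ(β)‖ ≤ ∫ ‖Φ‖` (the kernel has modulus `1`). [cite: Weil1965, Chap. I n° 2, p. 8] -/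
theorem norm_integral_mul_psiSqPi_le (c : ι → F) {Φ : (ι → F) → ℂ} (hΦ : Integrable Φ (Measure.pi fun _ : ι => μ))
    (β : F) : ‖∫ x, Φ x * psiSqPi ψ (fun i => β * c i) x ∂(Measure.pi fun _ : ι => μ)‖ ≤
      ∫ x, ‖Φ x‖ ∂(Measure.pi fun _ : ι => μ) := by
  refine norm_integral_le_of_norm_le hΦ.norm (Eventually.of_forall fun x => ?_)
  simp only [norm_mul, norm_psiSqPi, mul_one, le_refl]

/-- **Gauss transform of a coset indicator = product of one-variable coset integrals** (Fubini):
`∫_{Π(aᵢ+𝔭^ℓ)} ψ(β f) dμ^⊗ι = Πᵢ ∫_{aᵢ+𝔭^ℓ} ψ(β cᵢ x²) dx`. [cite: Weil1964, Chap. II n° 25 Prop. 3, p. 173] -/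
theorem integral_indicator_piCoset_mul_psiSqPi (c a : ι → F) (ℓ : ℤ) (β : F) :
    ∫ x, (piCoset F a ℓ).indicator (fun _ => (1 : ℂ)) x * psiSqPi ψ (fun i => β * c i) x ∂(Measure.pi fun _ : ι => μ) =
      ∏ i, ∫ x in a i +ᵥ primePowBall F ℓ, psiSq ψ (β * c i) x ∂μ := by
  rw [show (∏ i, ∫ x in a i +ᵥ primePowBall F ℓ, psiSq ψ (β * c i) x ∂μ) =
      ∫ x in piCoset F a ℓ, psiSqPi ψ (fun i => β * c i) x ∂(Measure.pi fun _ : ι => μ) from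
    (setIntegral_pi_psiSqPi μ (fun i => β * c i) (fun i => a i +ᵥ primePowBall F ℓ)).symm,
    ← integral_indicator (measurableSet_piCoset a ℓ)]
  refine integral_congr_ae (Eventually.of_forall fun x => ?_)
  simp only
  by_cases hx : x ∈ piCoset F a ℓ
  · rw [Set.indicator_of_mem hx, one_mul, Set.indicator_of_mem hx]
  · rw [Set.indicator_of_notMem hx, zero_mul, Set.indicator_of_notMem hx]

/-- **DECAY over a coset**: `‖∫_{Π(aᵢ+𝔭^ℓ)} ψ(β f)‖ ≤ C (√q)^{r j}` for `‖β‖ = q^{-j}`, `r = card ι` — the product of the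
one-variable decays (`‖β cᵢ‖ = q^{-(j + vᵢ)}`). [cite: Weil1965, Chap. I n° 2 Prop. 2, p. 8] -/
theorem exists_norm_integral_indicator_piCoset_mul_psiSqPi_le {d : ℤ} (hd : ψ.HasConductorExp d) {v₂ : ℤ}
    (h2 : normAbs F (2 : F) = (residueFieldCard F : ℝ≥0)⁻¹ ^ v₂) {c : ι → F} (hc : ∀ i, c i ≠ 0)
    (a : ι → F) (ℓ : ℤ) :
    ∃ C : ℝ, 0 ≤ C ∧ ∀ (β : F) (j : ℤ), normAbs F β = (residueFieldCard F : ℝ≥0)⁻¹ ^ j →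
      ‖∫ x, (piCoset F a ℓ).indicator (fun _ => (1 : ℂ)) x * psiSqPi ψ (fun i => β * c i) x ∂(Measure.pi fun _ : ι => μ)‖ ≤
        C * Real.sqrt (residueFieldCard F) ^ ((Fintype.card ι : ℤ) * j) := by
  set sq : ℝ := Real.sqrt (residueFieldCard F) with hsq
  have hsq0 : 0 < sq := sqrt_residueFieldCard_pos
  choose C hC0 hC using fun i => exists_norm_setIntegral_vadd_primePowBall_psiSq_le μ hd h2 (a i) ℓ
  choose v hv using fun i => exists_normAbs_eq_inv_zpow (hc i)
  refine ⟨∏ i, C i * sq ^ v i, Finset.prod_nonneg fun i _ => mul_nonneg (hC0 i) (zpow_nonneg hsq0.le _),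
    fun β j hβ => ?_⟩
  rw [integral_indicator_piCoset_mul_psiSqPi, norm_prod]
  have hβc : ∀ i, normAbs F (β * c i) = (residueFieldCard F : ℝ≥0)⁻¹ ^ (j + v i) := fun i => by
    rw [map_mul, hβ, hv, zpow_add₀ inv_residueFieldCard_pos.ne']
  calc ∏ i, ‖∫ x in a i +ᵥ primePowBall F ℓ, psiSq ψ (β * c i) x ∂μ‖
      ≤ ∏ i, C i * sq ^ v i * sq ^ j := Finset.prod_le_prod (fun i _ => norm_nonneg _) fun i _ => by
          rw [mul_assoc, ← zpow_add₀ hsq0.ne', add_comm]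
          exact hC i (β * c i) (j + v i) (hβc i)
    _ = (∏ i, C i * sq ^ v i) * sq ^ ((Fintype.card ι : ℤ) * j) := by
          rw [Finset.prod_mul_distrib, Finset.prod_const, Finset.card_univ, ← zpow_natCast, ← zpow_mul, mul_comm j]

omit [BorelSpace F] in
/-- `F` is second countable and a Haar measure on it is `σ`-finite (instance helpers). [folklore] -/
private theorem sigmaFinite_haar' : SigmaFinite μ := by
  haveI : T2Space F :=
    (Literature.NumberTheory.GaloisRepresentations.IsNonarchimedeanLocalField.isLocalField F).toT2Space
  haveI : LocallyCompactSpace F :=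
    (Literature.NumberTheory.GaloisRepresentations.IsNonarchimedeanLocalField.isLocalField F).toLocallyCompactSpace
  haveI : SecondCountableTopology F := secondCountableTopology_localField F
  infer_instance

omit [BorelSpace F] in
/-- a coset of a box has finite product measure. [folklore] -/
private theorem measure_piCoset_lt_top (a : ι → F) (ℓ : ℤ) : (Measure.pi fun _ : ι => μ) (piCoset F a ℓ) < ∞ := by
  haveI : SecondCountableTopology F := secondCountableTopology_localField F
  haveI := sigmaFinite_haar' μ
  rw [← vadd_piPrimePowBall_eq_piCoset]
  exact (isCompact_vadd_piPrimePowBall ℓ a).measure_lt_top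

/-- the weighted coset terms `Φ(a_B) 1_B ψ(β f)` are integrable. [folklore] -/
private theorem integrable_const_mul_indicator_piCoset_mul_psiSqPi (hψ : Continuous ψ) (c : ι → F) (z : ℂ) (a : ι → F)
    (ℓ : ℤ) (β : F) :
    Integrable (fun x => z * (piCoset F a ℓ).indicator (fun _ => (1 : ℂ)) x * psiSqPi ψ (fun i => β * c i) x)
      (Measure.pi fun _ : ι => μ) := by
  have e : (fun x => z * (piCoset F a ℓ).indicator (fun _ => (1 : ℂ)) x * psiSqPi ψ (fun i => β * c i) x) =
      (piCoset F a ℓ).indicator fun x => z * psiSqPi ψ (fun i => β * c i) x := by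
    funext x
    by_cases hx : x ∈ piCoset F a ℓ
    · rw [Set.indicator_of_mem hx, Set.indicator_of_mem hx, mul_one]
    · rw [Set.indicator_of_notMem hx, Set.indicator_of_notMem hx, mul_zero, zero_mul]
  rw [e]
  have h : IntegrableOn (fun x => z * psiSqPi ψ (fun i => β * c i) x) (piCoset F a ℓ) (Measure.pi fun _ : ι => μ) :=
    (integrableOn_psiSqPi μ hψ (fun i => β * c i) (measure_piCoset_lt_top μ a ℓ).ne).const_mul z
  exact h.integrable_indicator (measurableSet_piCoset a ℓ)

/-- **linearity over the step decomposition**: if `Φ = Σ_B Φ(a_B) 1_B` (cosets `B = a_B + (𝔭^N)^ι`) then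
`G_Φ = Σ_B Φ(a_B) G_{1_B}`. [cite: Weil1965, Chap. I n° 2, p. 8] -/
theorem integral_mul_psiSqPi_eq_sum_of_eq_sum (hψ : Continuous ψ) (c : ι → F) {Φ : (ι → F) → ℂ} {N : ℤ}
    {S : Finset (Set (ι → F))} {rep : Set (ι → F) → ι → F} (hrep : ∀ B ∈ S, B = rep B +ᵥ piPrimePowBall F ι N)
    (hsum : ∀ u, Φ u = ∑ B ∈ S, Φ (rep B) * B.indicator (fun _ => (1 : ℂ)) u) (β : F) :
    ∫ x, Φ x * psiSqPi ψ (fun i => β * c i) x ∂(Measure.pi fun _ : ι => μ) =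
      ∑ B ∈ S, Φ (rep B) * ∫ x, (piCoset F (rep B) N).indicator (fun _ => (1 : ℂ)) x *
        psiSqPi ψ (fun i => β * c i) x ∂(Measure.pi fun _ : ι => μ) := by
  have e : (fun x => Φ x * psiSqPi ψ (fun i => β * c i) x) = fun x =>
      ∑ B ∈ S, Φ (rep B) * (piCoset F (rep B) N).indicator (fun _ => (1 : ℂ)) x * psiSqPi ψ (fun i => β * c i) x := by
    funext x
    rw [hsum x, Finset.sum_mul]
    refine Finset.sum_congr rfl fun B hB => ?_
    rw [← vadd_piPrimePowBall_eq_piCoset, ← hrep B hB]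
  rw [e, integral_finsetSum S fun B _ =>
    integrable_const_mul_indicator_piCoset_mul_psiSqPi μ hψ c (Φ (rep B)) (rep B) N β]
  refine Finset.sum_congr rfl fun B _ => ?_
  rw [← integral_const_mul]
  refine integral_congr_ae (Eventually.of_forall fun x => ?_)
  simp only [mul_assoc]

/-- for a Schwartz–Bruhat `Φ` the integrand `Φ(x) ψ(β f(x))` of the Gauss transform is integrable (a finite sum of
bounded functions on compact cosets) — Weil's local integrals converge absolutely. [cite: Weil1965, Chap. I n° 2, p. 8] -/
theorem integrable_mul_psiSqPi_of_mem_schwartzBruhat (hψ : Continuous ψ) (c : ι → F) {Φ : (ι → F) → ℂ}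
    (hΦ : Φ ∈ SchwartzBruhat (ι → F)) (β : F) :
    Integrable (fun x => Φ x * psiSqPi ψ (fun i => β * c i) x) (Measure.pi fun _ : ι => μ) := by
  obtain ⟨N, S, rep, hrep, hsum⟩ := exists_finset_eq_sum_const_mul_indicator_pi hΦ
  have e : (fun x => Φ x * psiSqPi ψ (fun i => β * c i) x) = fun x =>
      ∑ B ∈ S, Φ (rep B) * (piCoset F (rep B) N).indicator (fun _ => (1 : ℂ)) x * psiSqPi ψ (fun i => β * c i) x := by
    funext x
    rw [hsum x, Finset.sum_mul]
    refine Finset.sum_congr rfl fun B hB => ?_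
    rw [← vadd_piPrimePowBall_eq_piCoset, ← hrep B hB]
  rw [e]
  exact integrable_finsetSum S fun B _ =>
    integrable_const_mul_indicator_piCoset_mul_psiSqPi μ hψ c (Φ (rep B)) (rep B) N β

/-- **WEIL'S DECAY ESTIMATE** [Weil1965, Chap. I n° 2 Prop. 2]: for a Schwartz–Bruhat function `Φ` on `F^ι` and a
diagonal non-degenerate form `f = Σ cᵢ xᵢ²` there is `C ≥ 0` with `‖∫ Φ(x) ψ(β f(x)) dx‖ ≤ C (√q)^{r j}` whenever
`‖β‖ = q^{-j}` (`r = card ι`), i.e. `‖G_Φ(β)‖ ≤ C ‖β‖^{-r/2}`.  (Weil: "`|F*_Φ(x*)|` … majorée par `C |x*|^{-m/2}`"; here for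
the standard diagonal forms over a `p`-field, by the step decomposition and the coset decay.)
[cite: Weil1965, Chap. I n° 2 Prop. 2, p. 8] -/
theorem exists_norm_integral_mul_psiSqPi_le_of_mem_schwartzBruhat {d : ℤ} (hd : ψ.HasConductorExp d) {v₂ : ℤ}
    (h2 : normAbs F (2 : F) = (residueFieldCard F : ℝ≥0)⁻¹ ^ v₂) {c : ι → F} (hc : ∀ i, c i ≠ 0)
    {Φ : (ι → F) → ℂ} (hΦ : Φ ∈ SchwartzBruhat (ι → F)) :
    ∃ C : ℝ, 0 ≤ C ∧ ∀ (β : F) (j : ℤ), normAbs F β = (residueFieldCard F : ℝ≥0)⁻¹ ^ j →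
      ‖∫ x, Φ x * psiSqPi ψ (fun i => β * c i) x ∂(Measure.pi fun _ : ι => μ)‖ ≤
        C * Real.sqrt (residueFieldCard F) ^ ((Fintype.card ι : ℤ) * j) := by
  have hψ : Continuous ψ := continuous_of_hasConductorExp hd
  obtain ⟨N, S, rep, hrep, hsum⟩ := exists_finset_eq_sum_const_mul_indicator_pi hΦ
  choose C hC0 hC using fun B => exists_norm_integral_indicator_piCoset_mul_psiSqPi_le μ hd h2 hc (rep B) N
  refine ⟨∑ B ∈ S, ‖Φ (rep B)‖ * C B, Finset.sum_nonneg fun B _ => mul_nonneg (norm_nonneg _) (hC0 B),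
    fun β j hβ => ?_⟩
  rw [integral_mul_psiSqPi_eq_sum_of_eq_sum μ hψ c hrep hsum β, Finset.sum_mul]
  refine (norm_sum_le _ _).trans (Finset.sum_le_sum fun B _ => ?_)
  rw [norm_mul, mul_assoc]
  exact mul_le_mul_of_nonneg_left (hC B β j hβ) (norm_nonneg _)

end SeveralVariables

end Literature.NumberTheory.Weil1965
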